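import Summits.QuantumFields.BalabanUV.Beta.GAN24.DerivativeRateTransferJensenMassFreeKarcherLattice
import Summits.QuantumFields.BalabanUV.Beta.GAN24.DerivativeRateTransferJensenMassFreePoincare

/-!
# `BalabanUV.Beta.GAN24.DerivativeRateTransferJensenMassFreeKarcherPoincare` — binder row G-an2-4 ∕ (CONV-C), route R6 «VALUES, NOT DERIVATIVES», PART 85:
# THE POLAR AND THE KARCHER PAIRS ON THE BLOCK LATTICE FROM THE PLAQUETTE LETTER ALONE — PART 84 with the block Poincaré data discharged by PART 64's comb datum
# (`Φ(y) = 4(d(L−1))²E_y(u)`, `ϖ′ = ϖ` for any `ϖ ≥ 0` with `w_c·4d(d(L−1))² ≤ ϖ·w_f`): for the THIRD printed convention, Bałaban–Jaffe's (1.27) ∕ (1.29), nothing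
# about the pair is left except the plaquette letter `p̂` (two smallness conditions) and the weights — the (1.27) twin of PART 64 (polar) and PART 75 ((1.28))
# (unit b2b-balaban-gan24-p3, gen 46; v1)

NOT IN PRINT; OUR PROOF (for the ROUTE; PART 84 `covJensen_karcher_lattice_of_plaquettes` + PART 64 `blockVar_comb_le` ∕ `combPoincare_budget_tgt` ∕ `_src` ∕
`nxt_eq_update` BY NAME — PART 75's proof verbatim).  HONEST FRAMING (cell contract, verbatim): «discharging `BetaPertH` makes Bałaban's UV stability UNCONDITIONAL — a
real constructive-QFT result; it is NOT the continuum limit and NOT the Clay problem.»  HONEST DEPENDENCY (verbatim): «continuum YM on T⁴ ⇐ BetaPertH ∧ nine spine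
estimates (0/9 proved); BetaPertH ⇐ (D1) ∧ (D4) ∧ CAP+tail; G-an2-4 gates asym, D1 and NE2/3/4.»

WHAT THIS FILE PROVES (0 sorry, 0 `def`, nothing cited): **`covJensen_karcher_lattice_of_plaquettes'`**.  HONEST SCOPE: crude count (`(d(L−1))²` per site), one
axis order, the root any prescribed block site, window `√(dim o)·2d(L−1)Lp̂ ≤ 1∕200`, crude constants (`1280, 200704`); ONE scale; NOT the tower, NOT (CONS), NOT
(CONV-C).  SUPPLIER work on route R6 (rank 2, REDUCTION, no seat); no consumer of record; NEVER «G-an2-4 closed»; NOT (CONV-C), NOT D1, NOT `BetaPertH`, NOT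
continuum, NOT Clay.  Records: `HOME/b2b-balaban-gan24-p3/WOODBURY-FIBRE.md` v14.6. -/

noncomputable section

open scoped Matrix Matrix.Norms.Frobenius
open NormedSpace Matrix Finset Function

namespace Summit.QuantumFields.BalabanUV.Beta.GAN24.DerivativeRateTransferJensenMassFreeKarcherPoincare

open Summit.QuantumFields.BalabanUV.Beta.GAN24.DerivativeRateTransferJensenChain
open Summit.QuantumFields.BalabanUV.Beta.GAN24.DerivativeRateTransferJensenLattice
open Summit.QuantumFields.BalabanUV.Beta.GAN24.DerivativeRateTransferJensenMassFreePoincare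
open Summit.QuantumFields.BalabanUV.Beta.GAN24.DerivativeRateTransferJensenMassFreeKarcherLattice

section End

variable {d L M : ℕ} {o : Type*} [Fintype o] [DecidableEq o]

/-- **`covJensen_karcher_lattice_of_plaquettes'` — THE POLAR AND THE KARCHER PAIRS ON THE BLOCK LATTICE FROM THE PLAQUETTE LETTER ALONE** [our proof; PART 84 +
PART 64 §2: the block Poincaré data `Φ ∕ ϖ ∕ ϖ′` discharged by the comb datum, `ϖ′ = ϖ` for any `ϖ ≥ 0` with `w_c·4d(d(L−1))² ≤ ϖ·w_f`]. -/
theorem covJensen_karcher_lattice_of_plaquettes' [NeZero M] (hL : 0 < L)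
    {R : ((Fin d → ZMod M) × (Fin d → Fin L)) × Fin d → Matrix o o ℝ} (hR : ∀ e, (R e)ᵀ * R e = 1) {phat : ℝ} (hphat : 0 ≤ phat)
    (hplaq : ∀ (p : (Fin d → ZMod M) × (Fin d → Fin L)) (μ' μ : Fin d), μ' ≠ μ → ∀ w : o → ℝ,
      ((R (p, μ') *
              R (((p.1 + (((p.2 μ' : ℕ) + 1) / L) • (Pi.single μ' (1 : ZMod M)), update p.2 μ' ⟨((p.2 μ' : ℕ) + 1) % L, Nat.mod_lt _ hL⟩) :
                (Fin d → ZMod M) × (Fin d → Fin L)), μ) *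
            (R (((p.1 + (((p.2 μ : ℕ) + 1) / L) • (Pi.single μ (1 : ZMod M)), update p.2 μ ⟨((p.2 μ : ℕ) + 1) % L, Nat.mod_lt _ hL⟩) :
                (Fin d → ZMod M) × (Fin d → Fin L)), μ'))ᵀ *
          (R (p, μ))ᵀ - 1) *ᵥ w) ⬝ᵥ
        ((R (p, μ') *
              R (((p.1 + (((p.2 μ' : ℕ) + 1) / L) • (Pi.single μ' (1 : ZMod M)), update p.2 μ' ⟨((p.2 μ' : ℕ) + 1) % L, Nat.mod_lt _ hL⟩) :
                (Fin d → ZMod M) × (Fin d → Fin L)), μ) *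
            (R (((p.1 + (((p.2 μ : ℕ) + 1) / L) • (Pi.single μ (1 : ZMod M)), update p.2 μ ⟨((p.2 μ : ℕ) + 1) % L, Nat.mod_lt _ hL⟩) :
                (Fin d → ZMod M) × (Fin d → Fin L)), μ'))ᵀ *
          (R (p, μ))ᵀ - 1) *ᵥ w) ≤ phat ^ 2 * (w ⬝ᵥ w))
    {W : (Fin d → ZMod M) → (Fin d → ZMod M) × (Fin d → Fin L) → Matrix o o ℝ} (hW : ∀ y x, (W y x)ᵀ * W y x = 1)
    (hWstep : ∀ (y : Fin d → ZMod M) (z : Fin d → Fin L) (μ : Fin d) (h : (z μ : ℕ) + 1 < L), (∀ ν, μ < ν → (z ν : ℕ) = 0) →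
      W y (y, update z μ ⟨(z μ : ℕ) + 1, h⟩) = W y (y, z) * R ((y, z), μ))
    {Q : Matrix ((Fin d → ZMod M) × o) (((Fin d → ZMod M) × (Fin d → Fin L)) × o) ℝ}
    (hQ : ∀ (u : ((Fin d → ZMod M) × (Fin d → Fin L)) × o → ℝ) (y : Fin d → ZMod M),
      (fun a => (Q *ᵥ u) (y, a)) = ∑ x, (if x.1 = y then ((L : ℝ) ^ d)⁻¹ else 0) • (W y x *ᵥ fun b => u (x, b)))
    {Hf : Matrix (((Fin d → ZMod M) × (Fin d → Fin L)) × o) (((Fin d → ZMod M) × (Fin d → Fin L)) × o) ℝ} {wf : ℝ}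
    (hHf : ∀ u : ((Fin d → ZMod M) × (Fin d → Fin L)) × o → ℝ,
      wf * ∑ e : ((Fin d → ZMod M) × (Fin d → Fin L)) × Fin d,
        ((R e *ᵥ fun b => u ((e.1.1 + ((((e.1.2 e.2 : ℕ) + 1) / L) • (Pi.single e.2 (1 : ZMod M))),
            update e.1.2 e.2 ⟨((e.1.2 e.2 : ℕ) + 1) % L, Nat.mod_lt _ hL⟩), b)) - fun b => u (e.1, b)) ⬝ᵥ
          ((R e *ᵥ fun b => u ((e.1.1 + ((((e.1.2 e.2 : ℕ) + 1) / L) • (Pi.single e.2 (1 : ZMod M))),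
            update e.1.2 e.2 ⟨((e.1.2 e.2 : ℕ) + 1) % L, Nat.mod_lt _ hL⟩), b)) - fun b => u (e.1, b)) ≤ u ⬝ᵥ (Hf *ᵥ u))
    {T : (Fin d → ZMod M) × Fin d → (Fin d → ZMod M) × (Fin d → Fin L) → ℕ → Matrix o o ℝ} (hT0 : ∀ e' x, T e' x 0 = 1)
    (hT : ∀ e' x i, i < L → T e' x (i + 1) = T e' x i *
      R (((x.1 + (((x.2 e'.2 : ℕ) + i) / L) • (Pi.single e'.2 (1 : ZMod M)),
            update x.2 e'.2 ⟨((x.2 e'.2 : ℕ) + i) % L, Nat.mod_lt _ hL⟩) : (Fin d → ZMod M) × (Fin d → Fin L)), e'.2))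
    (hsmall : 2 * (d * ((L : ℝ) - 1)) * (L * phat) < 1)
    (hsmall200 : Real.sqrt (Fintype.card o) * (2 * (d * ((L : ℝ) - 1)) * (L * phat)) ≤ 1 / 200)
    {x₀ : (Fin d → ZMod M) × Fin d → (Fin d → ZMod M) × (Fin d → Fin L)} (hx₀ : ∀ e', (x₀ e').1 = e'.1) :
    ∃ (R' V : (Fin d → ZMod M) × Fin d → Matrix o o ℝ)
      (C : ∀ e' : (Fin d → ZMod M) × Fin d,
        {x : (Fin d → ZMod M) × (Fin d → Fin L) // (if x.1 = e'.1 then ((L : ℝ) ^ d)⁻¹ else 0) ≠ 0} → Matrix o o ℝ),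
      (∀ e', (R' e')ᵀ * R' e' = 1) ∧ (∀ e', (V e')ᵀ * V e' = 1) ∧
      (∀ e', ‖V e' * (W e'.1 (x₀ e') * T e' (x₀ e') L *
          (W (e'.1 + Pi.single e'.2 1) (((Equiv.addRight (Pi.single e'.2 (1 : ZMod M))).prodCongr (Equiv.refl (Fin d → Fin L))) (x₀ e')))ᵀ)ᵀ - 1‖ ≤
        8 * (Real.sqrt (Fintype.card o) * (2 * (d * ((L : ℝ) - 1)) * (L * phat)))) ∧
      (∀ e' x, (C e' x)ᵀ = -C e' x) ∧
      (∀ e' x, exp (C e' x) * V e' =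
        W e'.1 x * T e' x L * (W (e'.1 + Pi.single e'.2 1) (((Equiv.addRight (Pi.single e'.2 (1 : ZMod M))).prodCongr (Equiv.refl (Fin d → Fin L))) x))ᵀ) ∧
      (∀ e' x, ‖C e' x‖ ≤ 8 * (Real.sqrt (Fintype.card o) * (2 * (d * ((L : ℝ) - 1)) * (L * phat)))) ∧
      (∀ e', ∑ x : {x : (Fin d → ZMod M) × (Fin d → Fin L) // (if x.1 = e'.1 then ((L : ℝ) ^ d)⁻¹ else 0) ≠ 0},
        (if (x : (Fin d → ZMod M) × (Fin d → Fin L)).1 = e'.1 then ((L : ℝ) ^ d)⁻¹ else 0) • C e' x = 0) ∧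
      ∀ (wc : ℝ) (_hwc : 0 ≤ wc) (_hw : wc * L * (L * ((L : ℝ) ^ d)⁻¹) ≤ wf) (ϖ : ℝ) (_hϖ0 : 0 ≤ ϖ)
        (_hϖ : wc * (4 * d * (d * ((L : ℝ) - 1)) ^ 2) ≤ ϖ * wf) (u : ((Fin d → ZMod M) × (Fin d → Fin L)) × o → ℝ)
        (s t r : ℝ) (_hs : 0 < s) (_ht : 0 < t) (_hr : 0 < r),
        (∀ Hc : Matrix ((Fin d → ZMod M) × o) ((Fin d → ZMod M) × o) ℝ,
          (∀ v : (Fin d → ZMod M) × o → ℝ, v ⬝ᵥ (Hc *ᵥ v) ≤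
            wc * ∑ e' : (Fin d → ZMod M) × Fin d, ((R' e' *ᵥ fun a => v (e'.1 + Pi.single e'.2 1, a)) - fun a => v (e'.1, a)) ⬝ᵥ
              ((R' e' *ᵥ fun a => v (e'.1 + Pi.single e'.2 1, a)) - fun a => v (e'.1, a))) →
          (Q *ᵥ u) ⬝ᵥ (Hc *ᵥ (Q *ᵥ u)) ≤
            (1 + t + (1 + t⁻¹) * (1 + r) * ϖ * (2 * (2 * (d * ((L : ℝ) - 1)) * (L * phat))) ^ 2 +
                (1 + t⁻¹) * (1 + r⁻¹) * (3 * (2 * (2 * (d * ((L : ℝ) - 1)) * (L * phat))) ^ 2 /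
                  (4 - (2 * (2 * (d * ((L : ℝ) - 1)) * (L * phat))) ^ 2)) * (1 + ϖ + ϖ)) * (u ⬝ᵥ (Hf *ᵥ u))) ∧
        (∀ Hc''' : Matrix ((Fin d → ZMod M) × o) ((Fin d → ZMod M) × o) ℝ,
          (∀ v : (Fin d → ZMod M) × o → ℝ, v ⬝ᵥ (Hc''' *ᵥ v) ≤
            wc * ∑ e' : (Fin d → ZMod M) × Fin d, ((V e' *ᵥ fun a => v (e'.1 + Pi.single e'.2 1, a)) - fun a => v (e'.1, a)) ⬝ᵥ
              ((V e' *ᵥ fun a => v (e'.1 + Pi.single e'.2 1, a)) - fun a => v (e'.1, a))) →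
          (Q *ᵥ u) ⬝ᵥ (Hc''' *ᵥ (Q *ᵥ u)) ≤
            (1 + s) * ((1 + t + (1 + t⁻¹) * (1 + r) * ϖ * (2 * (2 * (d * ((L : ℝ) - 1)) * (L * phat))) ^ 2 +
                (1 + t⁻¹) * (1 + r⁻¹) * (3 * (2 * (2 * (d * ((L : ℝ) - 1)) * (L * phat))) ^ 2 /
                  (4 - (2 * (2 * (d * ((L : ℝ) - 1)) * (L * phat))) ^ 2)) * (1 + ϖ + ϖ)) * (u ⬝ᵥ (Hf *ᵥ u))) +
              (1 + s⁻¹) * (1280 * (Real.sqrt (Fintype.card o) * (2 * (d * ((L : ℝ) - 1)) * (L * phat))) ^ 3 +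
                  200704 * (Real.sqrt (Fintype.card o) * (2 * (d * ((L : ℝ) - 1)) * (L * phat))) ^ 4) ^ 2 * wc * d *
                ((Q *ᵥ u) ⬝ᵥ (Q *ᵥ u))) := by
  obtain ⟨R', V, C, h1, hV, hV1, h3, h4, h5, h0, h6⟩ :=
    covJensen_karcher_lattice_of_plaquettes hL hR hphat hplaq hW hWstep hQ hHf hT0 hT hsmall hsmall200 hx₀
  refine ⟨R', V, C, h1, hV, hV1, h3, h4, h5, h0, fun wc hwc hw ϖ hϖ0 hϖ u s t r hs ht hr => ?_⟩
  -- the bond energy datum (PART 64 §3 verbatim)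
  have hF0 : ∀ e : ((Fin d → ZMod M) × (Fin d → Fin L)) × Fin d, 0 ≤
      ((R e *ᵥ fun b => u ((e.1.1 + ((((e.1.2 e.2 : ℕ) + 1) / L) • (Pi.single e.2 (1 : ZMod M))),
          update e.1.2 e.2 ⟨((e.1.2 e.2 : ℕ) + 1) % L, Nat.mod_lt _ hL⟩), b)) - fun b => u (e.1, b)) ⬝ᵥ
        ((R e *ᵥ fun b => u ((e.1.1 + ((((e.1.2 e.2 : ℕ) + 1) / L) • (Pi.single e.2 (1 : ZMod M))),
          update e.1.2 e.2 ⟨((e.1.2 e.2 : ℕ) + 1) % L, Nat.mod_lt _ hL⟩), b)) - fun b => u (e.1, b)) := fun e => dotProduct_self_nonneg' _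
  have hF : ∀ (y : Fin d → ZMod M) (z : Fin d → Fin L) (μ : Fin d) (h : (z μ : ℕ) + 1 < L),
      ((R ((y, z), μ) *ᵥ fun b => u ((y, update z μ ⟨(z μ : ℕ) + 1, h⟩), b)) - fun b => u ((y, z), b)) ⬝ᵥ
        ((R ((y, z), μ) *ᵥ fun b => u ((y, update z μ ⟨(z μ : ℕ) + 1, h⟩), b)) - fun b => u ((y, z), b)) ≤
      (fun e : ((Fin d → ZMod M) × (Fin d → Fin L)) × Fin d =>
        ((R e *ᵥ fun b => u ((e.1.1 + ((((e.1.2 e.2 : ℕ) + 1) / L) • (Pi.single e.2 (1 : ZMod M))),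
            update e.1.2 e.2 ⟨((e.1.2 e.2 : ℕ) + 1) % L, Nat.mod_lt _ hL⟩), b)) - fun b => u (e.1, b)) ⬝ᵥ
          ((R e *ᵥ fun b => u ((e.1.1 + ((((e.1.2 e.2 : ℕ) + 1) / L) • (Pi.single e.2 (1 : ZMod M))),
            update e.1.2 e.2 ⟨((e.1.2 e.2 : ℕ) + 1) % L, Nat.mod_lt _ hL⟩), b)) - fun b => u (e.1, b))) ((y, z), μ) := by
    intro y z μ h
    dsimp only
    rw [nxt_eq_update hL y z μ h]
  have hP := blockVar_comb_le hL hW hWstep hQ u hF0 hF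
  have hΦ := combPoincare_budget_tgt (L := L) (M := M) hF0 (hHf u) hϖ hϖ0
  have hΦ' := combPoincare_budget_src (L := L) (M := M) hF0 (hHf u) hϖ hϖ0
  refine h6 wc hwc hw u
    (fun u' y => 4 * (d * ((L : ℝ) - 1)) ^ 2 * ∑ z' : Fin d → Fin L, ∑ μ : Fin d,
      (fun e : ((Fin d → ZMod M) × (Fin d → Fin L)) × Fin d =>
        ((R e *ᵥ fun b => u' ((e.1.1 + ((((e.1.2 e.2 : ℕ) + 1) / L) • (Pi.single e.2 (1 : ZMod M))),
            update e.1.2 e.2 ⟨((e.1.2 e.2 : ℕ) + 1) % L, Nat.mod_lt _ hL⟩), b)) - fun b => u' (e.1, b)) ⬝ᵥ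
          ((R e *ᵥ fun b => u' ((e.1.1 + ((((e.1.2 e.2 : ℕ) + 1) / L) • (Pi.single e.2 (1 : ZMod M))),
            update e.1.2 e.2 ⟨((e.1.2 e.2 : ℕ) + 1) % L, Nat.mod_lt _ hL⟩), b)) - fun b => u' (e.1, b))) ((y, z'), μ))
    ϖ ϖ ?_ ?_ ?_ s t r hs ht hr
  · exact hP
  · exact hΦ
  · exact hΦ'

end End

end Summit.QuantumFields.BalabanUV.Beta.GAN24.DerivativeRateTransferJensenMassFreeKarcherPoincare

end
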